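import Summits.BirchSwinnertonDyer.Rank1Residual.X4.Gamma1ModularSymbols
import Literature.NumberTheory.EllipticCurves.EichlerShimuraPeriodsGamma1WeightTwoRealSpanProofs
import HarnessLib

/-!
# The modular symbols `{∞, r}_G`, `r ∈ ℚ`, of a weight-`2` cusp form `G` on `Γ₁(N)` lie in ONE
# finitely generated subgroup of `ℂ` (Manin's finiteness at level `Γ₁(N)`)

Cell `pub/bsd-wall` (D-0145 line `route-BirchSwinnertonDyer-CyclotomicUntwist` rev 9), width seat
`bsd-line-cycu-p4` g11; file B «`Γ₁` symbols finitely generated (Manin)» of the sibling lane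
«F1′ FROM A LATTICE» (cycu-p3 g9) on the child C1 `PSUntwistedLFunctionAtThree`
(stmt-BirchSwinnertonDyer-27548) of the crux K1 `PSRankOneLowerHalfAtThree`
(stmt-BirchSwinnertonDyer-21580). THEOREMS ONLY (no definition, no named fact, no `sorry`), landed
`--supports` K1. BSD is not proved by this file and no crux of the route is; K1/K2 stay OPEN and WHOLE.

WHAT. The lane reduces the research residual F1′ of C1 (growth `½` of the explicit Mazur–Tate–Teitelbaum
candidate, `PSCandidateUniqueness`) to: the complex symbol of the `α`-stabilised untwist
`G ∈ S₂(Γ₁(L))` takes its values `{∞, r}_G`, `r ∈ ℚ`, in a finitely generated `ℤ`-module. This file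
proves exactly that, for EVERY `N ≥ 1` and EVERY `G : CuspForm (Gamma1 N) 2`, in the tree's vocabulary
(`Summit.BirchSwinnertonDyer.Rank1Residual.NebentypusTwist.modularSymbol1 / plusSymbol1 / minusSymbol1`
of `X4/Gamma1ModularSymbols`, `{∞, r}_G = 2π ∫₀^∞ G(r + it) dt`):

* §1 `modularSymbol1_smul_infty` — the Manin formula at level `Γ₁(N)`:
  `{∞, a/c}_G = V_G(γτ) - V_{G|γ}(τ)` for `γ = (a b; c d) ∈ SL(2, ℤ)`, `c ≠ 0`, every `τ ∈ ℍ`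
  (`V_φ = verticalIntegral φ` of `ModularSymbolsProofs`; the `Γ₀(N)` statement is
  `modularSymbol_smul_infty`, whose proof is run verbatim on the tree's `isCuspFunction_one_gamma1` /
  `isCuspFunction_slash_gamma1`; the integrability half is already `integrableOn_modularSymbol1_integrand_smul`);
  hence `modularSymbol1_smul_infty_eq_periodFn1` / `modularSymbol1_eq_periodFn1_cuspMatrix`:
  **`{∞, γ∞}_G = 2πi · c_G(γ)`** with `c_G = periodFn1 0 G` the weight-two Eichler–Shimura period
  cocycle of `EichlerShimuraPeriodsGamma1` (`periodFn1_zero_eq`), at every rational `r = δ_r ∞`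
  (`cuspMatrix r`).
* §2 `exists_finset_periodFn1_mem_closure` — **all the periods `c_G(γ)`, `γ ∈ SL(2, ℤ)` (not only
  `γ ∈ Γ₀(N)`), lie in the subgroup generated by ONE finite set**: write `γ = σδ` with `σ ∈ Γ₀(N)` and
  `δ` the inverse of the chosen representative of the coset of `γ⁻¹` in the FINITE quotient
  `SL(2, ℤ) ⧸ Γ₀(N)` (Mathlib `instFiniteIndexGamma0`); the twisted cocycle relation `periodFn1_mul`
  gives `c_G(σδ) = c_{⟨σ⟩G}(δ) + c_G(σ)`, where `⟨σ⟩ G = diamondOp N 2 (Gamma0Map N σ) G` runs over the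
  finitely many diamond twists (`ZMod N` is finite) and `c_G(σ) = λ_{σ,0}(G)` is the value at `G` of a
  generator of the Eichler–Shimura period lattice `periodLatticeK1 0`, finitely generated by
  `periodLatticeK1_fg` (Shimura 1971, Prop. 8.6).
* §3 **`exists_finset_modularSymbol1_mem_span`**: `∃ T : Finset ℂ, ∀ r : ℚ, {∞, r}_G ∈ span_ℤ T`;
  **`exists_fg_addSubgroup_symbols_mem`**: one finitely generated `Λ ≤ ℂ` containing every
  `{∞, r}_G`, every plus symbol `({∞, r} + {∞, -r})/2` and every minus symbol (Manin 1972, Thm. 1.6 /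
  §1.7: "each `{0, r}` is a sum of finitely many `{γ(0), γ(∞)}`"; here obtained from the cocycle over
  the finitely generated `Γ₀(N)` instead of continued fractions).
* §4 the same in `Submodule ℤ ℂ` form (`exists_fg_submodule_symbols_mem`, `…_mul_symbols_mem`,
  `…_signed_symbols_mem`: scaled symbols `κ{∞,r}_G` and signed symmetrisations `κ({∞,r}_G + ε{∞,-r}_G)`).
* §5 the lattice clause in the ray-symbol idiom of `CyclotomicUntwistStabilisedTwistSymbol` (`Ψ_G` carried by
  its defining equation): `exists_fg_submodule_raySymbol_mem`, `exists_fg_submodule_signed_raySymbol_mem`.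

WHY (route bookkeeping). With cycu-p3 g9's file A (a `K`-valued sequence whose complex image lies in a
finitely generated subgroup is `p`-adically bounded, `K` a number field) and the identification of the
explicit candidate with `α^{-M} · (plus symbol of G at x/p^M)` (files C/D of that lane), §3 is the lattice
input that turns the modularity statement (★) «the `α`-stabilised untwist is a weight-2 cusp form on some
`Γ₁(L)`» into F1′; nothing about (★) is asserted here.

References: [cite: Manin1972, §1.5–1.7, Thm. 1.6]; [cite: Shimura1971, §8.2 (8.2.20), Prop. 8.6];
[cite: CremonaAlgorithms1997, §2.1–2.3, §2.10].
-/

noncomputable section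

open scoped MatrixGroups ModularForm

open CongruenceSubgroup MeasureTheory Set
open UpperHalfPlane hiding I
open Literature.NumberTheory.EllipticCurves.ModularForms
open Summit.BirchSwinnertonDyer.Rank1Residual.NebentypusTwist

-- single-conjunct summit: `Summit.BirchSwinnertonDyer.BirchSwinnertonDyer.…` repeats the name by design
set_option linter.dupNamespace false
set_option autoImplicit false

namespace Summit.BirchSwinnertonDyer.BirchSwinnertonDyer.Theorems.Gamma1SymbolLattice

variable {N : ℕ} [NeZero N]

/-! ### §1 The Manin formula `{∞, γ∞}_G = V_G(γτ) - V_{G|γ}(τ)` at level `Γ₁(N)` -/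

section Manin

variable (G : CuspForm (Gamma1 N) 2) (g : SL(2, ℤ))

/-- **The modular symbol `{∞, γ∞}_G` of a `Γ₁(N)`-form as a difference of Eichler integrals**: for
`γ = (a b; c d) ∈ SL(2, ℤ)` with `c ≠ 0` and every `τ ∈ ℍ`,
`{∞, a/c}_G = V_G(γτ) - V_{G|γ}(τ)` (`V_φ(τ) = 2π ∫₀^∞ φ(τ + it) dt`). Proof = the `Γ₀(N)` proof
`modularSymbol_smul_infty` verbatim: split `∫₀^∞ G(a/c + it) dt` at `t = 1/|c|`, the tail is
`V_G(γw₀)/2π`, the substitution `t = 1/(c²u)` turns the head into `-V_{G|γ}(w₀)/2π`, and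
`V_G(γτ) - V_{G|γ}(τ)` is independent of `τ` (Manin 1972, Prop. 1.4, §1.6; Cremona §2.10).
[cite: Manin1972, Prop. 1.4] -/
theorem modularSymbol1_smul_infty (hc : (g 1 0 : ℤ) ≠ 0) (τ : ℍ) :
    modularSymbol1 G (((g 0 0 : ℤ) : ℚ) / ((g 1 0 : ℤ) : ℚ)) =
      verticalIntegral ⇑G (g • τ) - verticalIntegral (⇑G ∣[(2 : ℤ)] g) τ := by
  have hCR : ((g 1 0 : ℤ) : ℝ) ≠ 0 := by exact_mod_cast hc
  have hCa : (0 : ℝ) < |((g 1 0 : ℤ) : ℝ)| := abs_pos.mpr hCR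
  have hT : (0 : ℝ) < 1 / |((g 1 0 : ℤ) : ℝ)| := by positivity
  rw [verticalIntegral_smul_sub_eq g (isCuspFunction_one_gamma1 G) (isCuspFunction_slash_gamma1 G g) τ
      (ofComplex (rayBase g))]
  set F : ℝ → ℂ := fun t ↦ G (ofComplex (((g 0 0 : ℤ) : ℂ) / ((g 1 0 : ℤ) : ℂ) + t * Complex.I))
    with hF
  have hFi := integrableOn_modularSymbol1_integrand_smul G g hc
  -- tail
  have htail : ∫ t in Ioi (1 / |((g 1 0 : ℤ) : ℝ)|), F t =
      ∫ t in Ioi (0 : ℝ), G (ofComplex (((g • ofComplex (rayBase g) : ℍ) : ℂ) + t * Complex.I)) := by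
    rw [integral_Ioi_eq_integral_Ioi_add]
    refine setIntegral_congr_fun measurableSet_Ioi fun t _ ↦ ?_
    simp only [hF, coe_smul_rayBase g hc]
    congr 2
    push_cast
    ring
  -- head
  have hhead : ∫ t in Ioo 0 (1 / |((g 1 0 : ℤ) : ℝ)|), F t =
      -∫ t in Ioi (0 : ℝ), (⇑G ∣[(2 : ℤ)] g)
        (ofComplex (((ofComplex (rayBase g) : ℍ) : ℂ) + t * Complex.I)) := by
    rw [← image_inv_ray hCR, integral_image_eq_integral_abs_deriv_smul
      measurableSet_Ioi (fun u hu ↦ (hasDerivAt_inv_ray hCR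
        (lt_trans hT hu).ne').hasDerivWithinAt) (injOn_inv_ray hCR _),
      ← integral_neg, integral_Ioi_eq_integral_Ioi_add]
    refine setIntegral_congr_fun measurableSet_Ioi fun u hu ↦ ?_
    rw [hF, jacobian_smul_ray_fun (⇑G) g hc (add_pos hu hT), coe_ofComplex_rayBase g hc]
    congr 3
    rw [rayBase]
    push_cast
    ring_nf
  have hsplit : ∫ t in Ioi (0 : ℝ), F t =
      (∫ t in Ioo 0 (1 / |((g 1 0 : ℤ) : ℝ)|), F t) + ∫ t in Ioi (1 / |((g 1 0 : ℤ) : ℝ)|), F t := by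
    rw [← Ioc_union_Ioi_eq_Ioi hT.le, setIntegral_union (Ioc_disjoint_Ioi le_rfl)
      measurableSet_Ioi (hFi.mono_set Ioc_subset_Ioi_self) (hFi.mono_set (Ioi_subset_Ioi hT.le)),
      integral_Ioc_eq_integral_Ioo]
  simp only [modularSymbol1, verticalIntegral]
  push_cast
  rw [hsplit, hhead, htail]
  ring

/-- **`{∞, γ∞}_G = 2πi · c_G(γ)`**: for `γ ∈ SL(2, ℤ)` with `c ≠ 0` the modular symbol at the cusp
`γ∞ = a/c` is `2πi` times the weight-two Eichler–Shimura period cocycle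
`c_G(γ) = periodFn1 0 G γ p = (i/2π)(V_{G|γ}(i) - V_G(γi))` of `EichlerShimuraPeriodsGamma1`
(independent of `p`, `periodFn1_zero_eq`). [cite: Shimura1971, §8.2 (8.2.20)] -/
theorem modularSymbol1_smul_infty_eq_periodFn1 (hc : (g 1 0 : ℤ) ≠ 0) (p : Fin 2 → ℂ) :
    modularSymbol1 G (((g 0 0 : ℤ) : ℚ) / ((g 1 0 : ℤ) : ℚ)) =
      2 * Real.pi * Complex.I * periodFn1 0 G g p := by
  have h0 : periodFn1 0 G g p = Complex.I / (2 * Real.pi) *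
      (verticalIntegral (⇑G ∣[(2 : ℤ)] g) UpperHalfPlane.I - verticalIntegral ⇑G (g • UpperHalfPlane.I)) := by
    rw [periodFn1_zero_eq]
    rfl
  rw [modularSymbol1_smul_infty G g hc UpperHalfPlane.I, h0]
  have hπ : (Real.pi : ℂ) ≠ 0 := by exact_mod_cast Real.pi_ne_zero
  have key : 2 * (Real.pi : ℂ) * Complex.I * (Complex.I / (2 * Real.pi)) = -1 := by
    rw [show 2 * (Real.pi : ℂ) * Complex.I * (Complex.I / (2 * Real.pi)) =
        Complex.I * Complex.I * (2 * Real.pi) / (2 * Real.pi) by ring, Complex.I_mul_I,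
      mul_div_assoc, div_self (mul_ne_zero two_ne_zero hπ), mul_one]
  rw [← mul_assoc, key]
  ring

/-- **`{∞, r}_G = 2πi · c_G(δ_r)`** at every rational cusp `r = δ_r ∞` (`δ_r = cuspMatrix r ∈ SL(2, ℤ)`,
`ModularSymbolsProofs`). [cite: Manin1972, Prop. 1.4] -/
theorem modularSymbol1_eq_periodFn1_cuspMatrix (r : ℚ) (p : Fin 2 → ℂ) :
    modularSymbol1 G r = 2 * Real.pi * Complex.I * periodFn1 0 G (cuspMatrix r) p := by
  rw [← modularSymbol1_smul_infty_eq_periodFn1 G (cuspMatrix r) (cuspMatrix_apply_one_zero_ne_zero r) p,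
    cuspMatrix_div]

omit [NeZero N] in
/-- In weight two the period cocycle does not depend on the polynomial variable `p`. [folklore] -/
theorem periodFn1_zero_apply_eq (γ : SL(2, ℤ)) (p p' : Fin 2 → ℂ) :
    periodFn1 0 G γ p = periodFn1 0 G γ p' := by
  rw [periodFn1_zero_eq, periodFn1_zero_eq]

end Manin

/-! ### §2 All periods `c_G(γ)`, `γ ∈ SL(2, ℤ)`, lie in one finitely generated subgroup -/

section Lattice

variable (G : CuspForm (Gamma1 N) 2)

omit [NeZero N] in
/-- **Coset decomposition**: every `γ ∈ SL(2, ℤ)` is `σ · δ` with `σ ∈ Γ₀(N)` and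
`δ = (out [γ⁻¹])⁻¹` determined by the class of `γ⁻¹` in the finite quotient `SL(2, ℤ) ⧸ Γ₀(N)`.
[folklore] -/
theorem exists_gamma0_mul_out_inv (γ : SL(2, ℤ)) :
    ∃ σ : Gamma0 N, γ = (σ : SL(2, ℤ)) *
      ((QuotientGroup.mk (s := Gamma0 N) γ⁻¹ : SL(2, ℤ) ⧸ Gamma0 N).out)⁻¹ := by
  obtain ⟨h, hh⟩ := QuotientGroup.mk_out_eq_mul (Gamma0 N) γ⁻¹
  refine ⟨h, ?_⟩
  rw [hh, mul_inv_rev, inv_inv, ← mul_assoc, mul_inv_cancel, one_mul]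

/-- **The twisted cocycle relation in weight two**: `c_G(σδ) = c_{⟨σ⟩G}(δ) + c_G(σ)` for `σ ∈ Γ₀(N)`,
`δ ∈ SL(2, ℤ)` (`periodFn1_mul` at `n = 0`, `p = 0`). [cite: Shimura1971, §8.2 p. 233] -/
theorem periodFn1_zero_gamma0_mul (σ : Gamma0 N) (δ : SL(2, ℤ)) :
    periodFn1 0 G ((σ : SL(2, ℤ)) * δ) 0 =
      periodFn1 0 (diamondOp N 2 (Gamma0Map N σ) G) δ 0 + periodFn1 0 G σ 0 := by
  rw [periodFn1_mul, Matrix.mulVec_zero]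
  rfl

/-- `c_G(σ) = λ_{σ,0}(G)` for `σ ∈ Γ₀(N)`: the value at `G` of a generator of the Eichler–Shimura period
lattice `periodLatticeK1 0`. [cite: Shimura1971, §8.4 (8.4.1)] -/
theorem periodFn1_zero_coe_eq_periodFunctionalK1 (σ : Gamma0 N) :
    periodFn1 0 G σ 0 = periodFunctionalK1 0 σ 0 G := by
  rw [periodFunctionalK1_apply]
  exact periodFn1_zero_apply_eq G σ _ _

/-- **The values `φ(G)`, `φ ∈ periodLatticeK1 0`, form a finitely generated subgroup of `ℂ`**, namely
the image of the finitely generated period lattice (`periodLatticeK1_fg`) under evaluation at `G`.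
[cite: Shimura1971, Prop. 8.6] -/
theorem exists_finset_periodLatticeK1_apply_mem_closure :
    ∃ S : Finset ℂ, ∀ φ ∈ periodLatticeK1 (N := N) 0, φ G ∈ AddSubgroup.closure (S : Set ℂ) := by
  classical
  obtain ⟨S₀, hS₀⟩ := periodLatticeK1_fg N 0
  let ev : Module.Dual ℂ (CuspForm (Gamma1 N) ((0 : ℕ) + 2)) →+ ℂ :=
    (LinearMap.applyₗ (R := ℂ) G).toAddMonoidHom
  refine ⟨S₀.image ev, fun φ hφ ↦ ?_⟩
  have hmem : ev φ ∈ (periodLatticeK1 (N := N) 0).map ev := AddSubgroup.mem_map_of_mem ev hφ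
  rw [← hS₀, AddMonoidHom.map_closure, ← Finset.coe_image] at hmem
  exact hmem

/-- **All weight-two periods of `G` over `SL(2, ℤ)` lie in one finitely generated subgroup**:
`∃ T` finite with `c_G(γ) ∈ ⟨T⟩` for every `γ ∈ SL(2, ℤ)` — `c_G(σδ) = c_{⟨d⟩G}(δ) + λ_{σ,0}(G)` with
`d = Gamma0Map σ ∈ ZMod N` (finite), `δ` among the finitely many inverses of coset representatives of
`SL(2, ℤ) ⧸ Γ₀(N)` (`instFiniteIndexGamma0`), and `λ_{σ,0}(G)` in the finitely generated image of
`periodLatticeK1 0`. [cite: Shimura1971, Prop. 8.6] -/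
theorem exists_finset_periodFn1_mem_closure :
    ∃ T : Finset ℂ, ∀ γ : SL(2, ℤ), periodFn1 0 G γ 0 ∈ AddSubgroup.closure (T : Set ℂ) := by
  classical
  haveI : Fintype (SL(2, ℤ) ⧸ Gamma0 N) := Fintype.ofFinite _
  obtain ⟨S, hS⟩ := exists_finset_periodLatticeK1_apply_mem_closure G
  let T₁ : Finset ℂ := Finset.univ.image fun dq : ZMod N × (SL(2, ℤ) ⧸ Gamma0 N) ↦
    periodFn1 0 (diamondOp N 2 dq.1 G) (dq.2.out)⁻¹ 0
  refine ⟨T₁ ∪ S, fun γ ↦ ?_⟩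
  obtain ⟨σ, hγ⟩ := exists_gamma0_mul_out_inv (N := N) γ
  rw [hγ, periodFn1_zero_gamma0_mul, Finset.coe_union]
  refine add_mem ?_ ?_
  · refine AddSubgroup.closure_mono subset_union_left (AddSubgroup.subset_closure ?_)
    simp only [T₁, Finset.coe_image, Finset.coe_univ, Set.image_univ, Set.mem_range, Prod.exists]
    exact ⟨Gamma0Map N σ, QuotientGroup.mk γ⁻¹, rfl⟩
  · rw [periodFn1_zero_coe_eq_periodFunctionalK1]
    exact AddSubgroup.closure_mono subset_union_right (hS _ (periodFunctionalK1_mem σ 0))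

end Lattice

/-! ### §3 The symbols `{∞, r}_G`, `r ∈ ℚ`, and the plus/minus symbols lie in a finitely generated lattice -/

section Symbols

variable (G : CuspForm (Gamma1 N) 2)

/-- **Manin's finiteness for `Γ₁(N)`, closure form**: there is a finite set `T ⊂ ℂ` with
`{∞, r}_G ∈ ⟨T⟩` for every rational `r` (`{∞, r}_G = 2πi c_G(δ_r)`, §1, and §2).
[cite: Manin1972, Thm. 1.6] -/
theorem exists_finset_modularSymbol1_mem_closure :
    ∃ T : Finset ℂ, ∀ r : ℚ, modularSymbol1 G r ∈ AddSubgroup.closure (T : Set ℂ) := by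
  classical
  obtain ⟨T, hT⟩ := exists_finset_periodFn1_mem_closure G
  let m : ℂ →+ ℂ := AddMonoidHom.mulLeft (2 * Real.pi * Complex.I)
  refine ⟨T.image m, fun r ↦ ?_⟩
  rw [modularSymbol1_eq_periodFn1_cuspMatrix G r 0]
  have hmem : m (periodFn1 0 G (cuspMatrix r) 0) ∈ (AddSubgroup.closure (T : Set ℂ)).map m :=
    AddSubgroup.mem_map_of_mem m (hT _)
  rw [AddMonoidHom.map_closure] at hmem
  simpa [m, Finset.coe_image] using hmem

/-- **Manin's finiteness for `Γ₁(N)`, `ℤ`-span form**: there is a finite set `T ⊂ ℂ` with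
`{∞, r}_G ∈ span_ℤ T` for every rational `r`. [cite: Manin1972, Thm. 1.6] -/
theorem exists_finset_modularSymbol1_mem_span :
    ∃ T : Finset ℂ, ∀ r : ℚ, modularSymbol1 G r ∈ Submodule.span ℤ (T : Set ℂ) := by
  obtain ⟨T, hT⟩ := exists_finset_modularSymbol1_mem_closure G
  refine ⟨T, fun r ↦ ?_⟩
  rw [← Submodule.mem_toAddSubgroup, Submodule.span_int_eq_addSubgroupClosure]
  exact hT r

/-- **One finitely generated lattice for all the symbols of `G`**: there is a finitely generated
subgroup `Λ ≤ ℂ` containing every modular symbol `{∞, r}_G`, every plus symbol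
`({∞, r}_G + {∞, -r}_G)/2` and every minus symbol `({∞, r}_G - {∞, -r}_G)/2`, `r ∈ ℚ` (take
`Λ = ⟨T/2⟩` for the finite set `T` of `exists_finset_modularSymbol1_mem_closure`).
[cite: Manin1972, Thm. 1.6 and §1.7] -/
theorem exists_fg_addSubgroup_symbols_mem :
    ∃ Λ : AddSubgroup ℂ, Λ.FG ∧ ∀ r : ℚ,
      modularSymbol1 G r ∈ Λ ∧ plusSymbol1 G r ∈ Λ ∧ minusSymbol1 G r ∈ Λ := by
  classical
  obtain ⟨T, hT⟩ := exists_finset_modularSymbol1_mem_closure G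
  let h : ℂ →+ ℂ := AddMonoidHom.mulRight ((2 : ℂ)⁻¹)
  refine ⟨AddSubgroup.closure ((T.image h : Finset ℂ) : Set ℂ), ⟨_, rfl⟩, fun r ↦ ?_⟩
  -- every `x ∈ ⟨T⟩` has `x/2 ∈ ⟨T/2⟩`, hence also `x = x/2 + x/2 ∈ ⟨T/2⟩`
  have hhalf : ∀ x ∈ AddSubgroup.closure (T : Set ℂ),
      x * (2 : ℂ)⁻¹ ∈ AddSubgroup.closure ((T.image h : Finset ℂ) : Set ℂ) := by
    intro x hx
    have hmem : h x ∈ (AddSubgroup.closure (T : Set ℂ)).map h := AddSubgroup.mem_map_of_mem h hx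
    rw [AddMonoidHom.map_closure] at hmem
    simpa [h, Finset.coe_image] using hmem
  have hwhole : ∀ x ∈ AddSubgroup.closure (T : Set ℂ),
      x ∈ AddSubgroup.closure ((T.image h : Finset ℂ) : Set ℂ) := by
    intro x hx
    have := add_mem (hhalf x hx) (hhalf x hx)
    convert this using 1
    ring
  refine ⟨hwhole _ (hT r), ?_, ?_⟩
  · rw [plusSymbol1, div_eq_mul_inv]
    exact hhalf _ (add_mem (hT r) (hT (-r)))
  · rw [minusSymbol1, div_eq_mul_inv]
    exact hhalf _ (sub_mem (hT r) (hT (-r)))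

/-- **Finitely many `ℤ`-translates of symbols stay in the lattice**: for the `Λ` above, every finite
`ℤ`-combination `∑ i ∈ s, n i • {∞, r i}_G` lies in `Λ` (the shape in which twisted symbol sums
`∑_u η(u) {∞, r + u/m}` with INTEGER coefficients are consumed). [folklore] -/
theorem exists_fg_addSubgroup_sum_zsmul_modularSymbol1_mem :
    ∃ Λ : AddSubgroup ℂ, Λ.FG ∧ (∀ r : ℚ, modularSymbol1 G r ∈ Λ ∧ plusSymbol1 G r ∈ Λ) ∧
      ∀ {ι : Type*} (s : Finset ι) (n : ι → ℤ) (r : ι → ℚ),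
        ∑ i ∈ s, n i • modularSymbol1 G (r i) ∈ Λ ∧ ∑ i ∈ s, n i • plusSymbol1 G (r i) ∈ Λ := by
  obtain ⟨Λ, hΛ, hmem⟩ := exists_fg_addSubgroup_symbols_mem G
  refine ⟨Λ, hΛ, fun r ↦ ⟨(hmem r).1, (hmem r).2.1⟩, fun s n r ↦ ⟨?_, ?_⟩⟩
  · exact AddSubgroup.sum_mem _ fun i _ ↦ AddSubgroup.zsmul_mem _ (hmem (r i)).1 _
  · exact AddSubgroup.sum_mem _ fun i _ ↦ AddSubgroup.zsmul_mem _ (hmem (r i)).2.1 _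

end Symbols

/-! ### §4 `ℤ`-submodule packaging (the shape consumed by `PSF1OfLattice.exists_isUntwistedPAdicLFunction_of_lattice`) -/

section SubmodulePackaging

variable (G : CuspForm (Gamma1 N) 2)

/-- **One finitely generated `ℤ`-submodule of `ℂ` for all the symbols of `G`** (`Submodule ℤ ℂ` form of
`exists_fg_addSubgroup_symbols_mem`, via `AddSubgroup.toIntSubmodule`): `∃ Λ : Submodule ℤ ℂ`, `Λ.FG`,
containing every `{∞, r}_G`, every plus symbol and every minus symbol of `G`, `r ∈ ℚ` — the hypothesis
shape `(hΛ : Λ.FG) (hΨΛ : ∀ M a, Ψ (a / p ^ M) ∈ Λ)` of the lattice criterion for F1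
(`CyclotomicUntwistF1OfLattice`). [cite: Manin1972, Thm. 1.6 and §1.7] -/
theorem exists_fg_submodule_symbols_mem :
    ∃ Λ : Submodule ℤ ℂ, Λ.FG ∧ ∀ r : ℚ,
      modularSymbol1 G r ∈ Λ ∧ plusSymbol1 G r ∈ Λ ∧ minusSymbol1 G r ∈ Λ := by
  obtain ⟨Λ, hΛ, hmem⟩ := exists_fg_addSubgroup_symbols_mem G
  refine ⟨AddSubgroup.toIntSubmodule Λ, ?_, fun r ↦ hmem r⟩
  rwa [Submodule.fg_iff_addSubgroup_fg, AddSubgroup.toIntSubmodule_toAddSubgroup]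

/-- **Scaled symbols stay in a finitely generated `ℤ`-submodule**: for any fixed `κ : ℂ` (e.g. the
normalisation `1/(2κ'Ω⁺_f)` of a signed symmetrisation), `∃ Λ : Submodule ℤ ℂ`, `Λ.FG`, with
`κ · {∞, r}_G`, `κ · plusSymbol1 G r`, `κ · minusSymbol1 G r ∈ Λ` for all `r ∈ ℚ` (the image of the
lattice of `exists_fg_submodule_symbols_mem` under multiplication by `κ`). [folklore] -/
theorem exists_fg_submodule_mul_symbols_mem (κ : ℂ) :
    ∃ Λ : Submodule ℤ ℂ, Λ.FG ∧ ∀ r : ℚ,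
      κ * modularSymbol1 G r ∈ Λ ∧ κ * plusSymbol1 G r ∈ Λ ∧ κ * minusSymbol1 G r ∈ Λ := by
  obtain ⟨Λ, hΛ, hmem⟩ := exists_fg_submodule_symbols_mem G
  let μ : ℂ →ₗ[ℤ] ℂ := (AddMonoidHom.mulLeft κ).toIntLinearMap
  refine ⟨Λ.map μ, hΛ.map μ, fun r ↦ ⟨?_, ?_, ?_⟩⟩
  · exact Submodule.mem_map_of_mem (hmem r).1
  · exact Submodule.mem_map_of_mem (hmem r).2.1
  · exact Submodule.mem_map_of_mem (hmem r).2.2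

/-- **Signed symmetrisations**: for fixed `κ ε : ℂ` the values `κ · ({∞, r}_G + ε {∞, -r}_G)`, `r ∈ ℚ`
(`ε = η(-1) = ±1` gives `2κ` times the plus / minus symbol; any `ε` is allowed) lie in one finitely
generated `ℤ`-submodule of `ℂ` together with the `κ · {∞, r}_G`. [folklore] -/
theorem exists_fg_submodule_signed_symbols_mem (κ ε : ℂ) :
    ∃ Λ : Submodule ℤ ℂ, Λ.FG ∧ ∀ r : ℚ, κ * modularSymbol1 G r ∈ Λ ∧
      κ * (modularSymbol1 G r + ε * modularSymbol1 G (-r)) ∈ Λ := by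
  obtain ⟨Λ₁, hΛ₁, h₁⟩ := exists_fg_submodule_mul_symbols_mem G κ
  obtain ⟨Λ₂, hΛ₂, h₂⟩ := exists_fg_submodule_mul_symbols_mem G (κ * ε)
  refine ⟨Λ₁ ⊔ Λ₂, hΛ₁.sup hΛ₂, fun r ↦ ⟨Submodule.mem_sup_left (h₁ r).1, ?_⟩⟩
  rw [mul_add, ← mul_assoc]
  exact Submodule.add_mem_sup (h₁ r).1 (h₂ (-r)).1

end SubmodulePackaging

/-! ### §5 The ray-symbol idiom of `CyclotomicUntwistStabilisedTwistSymbol` (`Ψ_G` carried by its defining equation) -/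

section RaySymbol

variable (G : CuspForm (Gamma1 N) 2) (ΨG : ℚ → ℂ)
  (hΨG : ∀ r : ℚ, ΨG r = 2 * Real.pi * ∫ t in Ioi (0 : ℝ), G (ofComplex ((r : ℂ) + t * Complex.I)))

omit [NeZero N] in
include hΨG in
/-- The ray symbol of `PSStabilisedTwist` (a function `Ψ_G` with the defining hypothesis-equation
`Ψ_G(r) = 2π ∫₀^∞ G(r + it) dt`) IS the tree's `modularSymbol1 G`. [folklore] -/
theorem raySymbol_eq_modularSymbol1 (r : ℚ) : ΨG r = modularSymbol1 G r := by
  rw [hΨG]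
  rfl

include hΨG in
/-- **The lattice clause for the ray symbol** (idiom of `PSStabilisedTwist.exists_fg_forall_psi_mem`, whose
`hΛG`/`hmem` it discharges for EVERY `G` on `Γ₁(N)`; `hGint` there is `integrableOn_modularSymbol1_integrand`):
`∃ ΛG : Submodule ℤ ℂ`, `ΛG.FG`, `∀ r, Ψ_G(r) ∈ ΛG`. [cite: Manin1972, Thm. 1.6] -/
theorem exists_fg_submodule_raySymbol_mem :
    ∃ ΛG : Submodule ℤ ℂ, ΛG.FG ∧ ∀ r : ℚ, ΨG r ∈ ΛG := by
  obtain ⟨Λ, hΛ, hmem⟩ := exists_fg_submodule_symbols_mem G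
  exact ⟨Λ, hΛ, fun r ↦ (raySymbol_eq_modularSymbol1 G ΨG hΨG r) ▸ (hmem r).1⟩

include hΨG in
/-- The same for a signed symmetrisation `(Ψ_G(r) + ε Ψ_G(−r)) · c`, fixed `ε c : ℂ` (the `Ψ` of
`PSStabilisedTwist.psi_sub_eq_sum_ratPlusSymbol` has `ε = η(−1)`, `c = (2κΩ⁺_f)⁻¹`). [folklore] -/
theorem exists_fg_submodule_signed_raySymbol_mem (ε c : ℂ) :
    ∃ Λ : Submodule ℤ ℂ, Λ.FG ∧ ∀ r : ℚ, (ΨG r + ε * ΨG (-r)) * c ∈ Λ := by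
  obtain ⟨Λ, hΛ, hmem⟩ := exists_fg_submodule_signed_symbols_mem G c ε
  refine ⟨Λ, hΛ, fun r ↦ ?_⟩
  rw [raySymbol_eq_modularSymbol1 G ΨG hΨG r, raySymbol_eq_modularSymbol1 G ΨG hΨG (-r), mul_comm]
  exact (hmem r).2

end RaySymbol

end Summit.BirchSwinnertonDyer.BirchSwinnertonDyer.Theorems.Gamma1SymbolLattice

end
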